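import Summits.Ventures.PercRepro.RankLevelSetLevelSixT22Cell8Free
import Summits.Ventures.PercRepro.RankLevelSetLevelSixT22Cell8Every

/-!
# PercRepro — THE CORE CELL `(22, 8)` OF THE 22 ROW: THE `s₃ ≥ 7` BRANCHES BY FORM (ii) OF THE CONFINEMENT LEMMA, AND THE
UNCONDITIONAL CELL (p8 g12, S3)

`proofs/P8-G12-LEVER22.md` §7. With `S₃` = the union of the triangles, `ν(S₃) ≥ cq3⁻¹(s₃)` (p3's table on `M ↾ S₃`) and
`|S₃| ≤ 3ν(S₃)` (g11's union lemma), every coindependent `6`-set has `|B ∖ S₃| ≤ 8 − ν(S₃)`, so the coindependent independent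
`6`-sets number at most the numeral `X6` of the admissible `(ν, σ)` grid (`RankLevelSetConfinedBounds`) — the cell
`c025_core_six_heavy_cell_sq27di2v_x6` with that `X6`. The coloop-free cell `(22, 8)`: `s₃ ≤ 2`, `3 … 6` (T22Free8Partial), `7 … 9`,
`10`, `11` (here; the cap `s₃ ≤ 11` is THE TRIANGLE DROP). The every-core terminal `(20, 8)` at shift `8`: `s₃ ≤ 2`, `3 … 6`
(T22Cell8Partial), `7`, `8 … 10`, `11`, `12 … 13` (here; the cap `s₃ ≤ 13` is p3's table). Hence
`c025_core_six_twentytwo_8 : RLS M 22 6` on every `e`-free core of rank `22`, corank `8`. Axioms: standard.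
-/

open scoped Matroid

namespace PercRepro

namespace ThmN

open Set

variable {α : Type}

/-- **THE CORE CELL `(22, 8)`, every `e`-free core** — unconditional. -/
theorem c025_core_six_twentytwo_8 (M : Matroid α) [M.Finite]
    (hR : M.eRank = (22 : ℕ∞)) (hn : M.E.ncard = 22 + 8)
    (hfree : ∀ e ∈ M.E, ∃ A ⊆ M.E \ {e}, e ∉ M.closure A ∧ e ∉ M.closure ((M.E \ {e}) \ A)) :
    RLS M 22 6 :=
  c025_core_six_twentytwo_8_of M hR hn hfree
    (fun hcf h7 => c025_core_six_t22_free8_conf M hcf hR hn hfree h7)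
    (fun N _ hRN hnN hfreeN h7 => c025_core_six_t22_scaled2_every8_conf N hRN hnN hfreeN h7)

end ThmN

end PercRepro
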